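import Summits.CriticalPhenomena.PercolationContinuityZ3.Theses.PercBudgetLadder
import Literature.Probability.Percolation.MinOpenCut
import Summits.CriticalPhenomena.PercolationContinuityZ3.Theorems.DefectDimension.Negative.AllOpenCutsets

/-!
# Line `anchored-density-contraction` — skeleton for crux `PercBudgetLadder.DefectDimension`
(item stmt-CriticalPhenomena-5250 · route route-CriticalPhenomena-PercBudgetLadder · crux-plan
planner-cruxplan-stmt-CriticalPhenomena-5250-anchored-density-con-0, 2026-08-16)

Crux (rung r4, milestone): `DefectDimension : ∃ c > 0, P_{p_c(ℤ³)}(MinCut(n,2n) ≤ n^{2-c}) → 1`.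

Idea (card `Cruxes/DefectDimension/Ideas/anchored-density-contraction.md`, ideator 1; triage r1:
3 × pass): work with Kesten's ANCHORED face cut of the slab box `Q(M,H) = [0,M]²×[0,H] ⊆ ℤ³`
with anchor height `A`,
  `τ(M,H,A)(ω) = minOpenCutIn Q(M,H) (bottom ∪ lateral∩{x₂ < A}) (top ∪ lateral∩{x₂ ≥ A}) ω`,
the least number of open edges on an edge set separating the lower half of `∂Q` from the upper
half — a cut surface PINNED to the curve `∂[0,M]² × {A}`.  At scale `m` the box is
`(M,H,A) = (8m, 2m, m)`; write `E_p(m) := E_p τ(8m,2m,m)` and `u_k := E_{p_c}(2^k)/4^k`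
(the anchored pinhole DENSITY at octave `k`, `dens k` below).  Three registered stubs and one
proved reduction:

* `stub_gluing`   (C1, provable now, M): `E_p(2n) ≤ 4·E_p(n)` at EVERY `p`, `n ≥ 1` — exact dyadic
  sub-multiplicativity: Kesten's seamless lateral gluing (G1) of the four scale-`n` boxes tiling the
  middle sub-slab of the scale-`2n` box, plus the new vertical step (G2: an anchored cut of the
  middle sub-slab `{n ≤ x₂ ≤ 3n}` of `Q(16n,4n)` anchored at `2n` IS an anchored cut of `Q(16n,4n)`
  anchored at `2n`), pointwise for lattice configurations, then translation invariance.  Hence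
  `u_{k+1} ≤ u_k` exactly (no seam, margin or error term).
* `stub_routing`  (C2, provable now, M): `E_p MinCut(n,2n) ≤ 96·E_p(m)` whenever `4m ≤ n < 8m`
  (six face slabs × a `4 × 4` lateral tiling by anchored boxes of scale `m`, glued by G1; region
  anti-monotonicity; the routing lemma `minOpenCutIn_le_sum_of_routing` in its `ω ⊆ E(ℤ³)` form).
* `stub_contraction` (C3′, THE OPEN CORE, L–XL): for some `q ∈ (0,1)` and `δ > 0`, eventually in
  `K`, at least `δK` of the octaves `k < K` are CONTRACTING: `E_{p_c}(2^{k+1}) ≤ 4(1-q)·E_{p_c}(2^k)`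
  (i.e. `u_{k+1} ≤ (1-q)u_k`: releasing the internal pins of the glued competitor saves a fixed
  fraction) — the density-of-good-octaves form asked for by triage r1-1 (i) / r1-3 (ii), weaker
  than the card's uniform `AnchoredContraction`.
* `defectDimension_of_meanBound` (the MEAN normal form of r4, PROVED here, §4b): a polynomial
  mean bound `E_{p_c} MinCut(n,2n) ≤ C·n^{2-c}` (`c > 0`, eventually) implies the crux with saving
  `c/2` (the pairs of `box 2n` are an open cutset for every `ω`, so `MinCut(n,2n) < ⊤`; measurability
  via `ENat.measurable_iff` + `measurableSet_setOf_minOpenCutIn_le`; integrability; Markov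
  `mul_meas_ge_le_integral_of_nonneg`; `minOpenCutIn_le_iff` + `Nat.le_floor_iff`).  The crux-wide
  normal form recommended by triage r1-1/r1-3, usable by every other engine line.

Composition `DefectDimension_of` (kernel-checked, no `sorry`): C1 ⇒ `u` non-increasing; with C3′,
`u_K ≤ u_0 (1-q)^{#good octaves < K} ≤ u_0 ((1-q)^δ)^K` for `K ≥ K₀` (`decay_of_good_octaves`);
with `κ := -log₂((1-q)^δ) > 0` and `4·2^j ≤ n < 8·2^j`, C2 gives
`E MinCut(n,2n) ≤ 96·4^j·u_j ≤ 6·u_0·8^κ·n^{2-κ}`; `defectDimension_of_meanBound` concludes with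
saving `κ/2` (`κ = δ·log₂(1/(1-q))`).

Disproof honoured (`Cruxes/DefectDimension/Disproof.lean`, cdisprove v2, read 2026-08-16; no
`_false_without_` theorem exists yet): §2.4 / `Negative.AllOpenCutsets.defectDimension_false_at_one`
— the crux is FALSE at `p = 1`; on this line `p < 1`/criticality is used EXACTLY at
`stub_contraction` (C1, C2 and the mean form hold at every `p`; at `p = 1`,
`τ(8m,2m,m) = (8m+1)²` deterministically, `u_{k+1}/u_k → 1`, no octave contracts), so the stub set
is consistent with the landed negative lemma; `Negative.Subcritical.defectDimension_shape_below_critical`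
— below `p_c` every octave contracts (sharpness), again consistent.  §3 `saving_le_two`: the line's
saving is `< κ ≤ 1` (perimeter-forced edges give `u_k ≥ p_c 2^{-k-1}·(const)`), inside `(0,2]`.
§4 `DefectDimAt.zhangBaseAt`: `u_k → 0` is the anchored twin of `ZhangBase`; C3′ upgrades it to a
geometric rate along a positive density of octaves.  Negatives index (`ledger negatives`): untouched
(no entry on min-cuts / max-flows).

Layout: §0 local vocabulary (abbreviations only; the registered stubs never mention them) · §1 the
three stub statements, name-keyed and DEF-FREE (`Sig.stub_*`) · §2 the registered stubs (the only
`sorry`s) + definitional consistency · §3 `rfl` bridges to the vocabulary · §4 the real-analysis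
lemma · §4b the mean normal form, proved · §5 the composition `DefectDimension_of` (concludes the
crux BY NAME) · §6 negative lemmas.
-/

noncomputable section

open MeasureTheory Filter
open Literature.Probability.Percolation Literature.Probability.LatticeModels
open scoped Topology

namespace Summit.CriticalPhenomena.PercolationContinuityZ3.Cruxes.DefectDimension.AnchoredDensityContraction

/-! ## §0 Vocabulary (local abbreviations; the registered stubs of §2 spell everything out) -/

/-- The slab box `Q(M,H) = [0,M] × [0,M] × [0,H] ⊆ ℤ³`. [cite: Kesten1987, §2] -/
def slab (M H : ℕ) : Set (Site 3) :=
  {x : Site 3 | 0 ≤ x 0 ∧ x 0 ≤ ((M : ℕ) : ℤ) ∧ 0 ≤ x 1 ∧ x 1 ≤ ((M : ℕ) : ℤ) ∧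
    0 ≤ x 2 ∧ x 2 ≤ ((H : ℕ) : ℤ)}

/-- Anchored SOURCES: the bottom plane and the lateral planes strictly below the anchor height `A`
(only their trace on `Q(M,H)` matters to `minOpenCutIn`). [cite: RossignolTheret2018, §2.1] -/
def low (M A : ℕ) : Set (Site 3) :=
  {x : Site 3 | x 2 = 0 ∨ ((x 0 = 0 ∨ x 0 = ((M : ℕ) : ℤ) ∨ x 1 = 0 ∨ x 1 = ((M : ℕ) : ℤ)) ∧
    x 2 < ((A : ℕ) : ℤ))}

/-- Anchored SINKS: the top plane `x₂ = H` and the lateral planes at height `≥ A`. [cite: RossignolTheret2018, §2.1] -/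
def high (M H A : ℕ) : Set (Site 3) :=
  {x : Site 3 | x 2 = ((H : ℕ) : ℤ) ∨ ((x 0 = 0 ∨ x 0 = ((M : ℕ) : ℤ) ∨ x 1 = 0 ∨ x 1 = ((M : ℕ) : ℤ)) ∧
    ((A : ℕ) : ℤ) ≤ x 2)}

/-- **Kesten's anchored face cut** `τ(M,H,A)(ω) ∈ ℕ∞`: the min-cut budget between the two halves
of `∂Q(M,H)` split at anchor height `A` (finite for `1 ≤ A ≤ H`). [cite: Kesten1987, §2] -/
abbrev anchCut (M H A : ℕ) (ω : BondConfig (Site 3)) : ℕ∞ :=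
  minOpenCutIn (slab M H) (low M A) (high M H A) ω

/-- `E_p τ(M,H,A)`. [folklore] -/
def expCut (p : unitInterval) (M H A : ℕ) : ℝ :=
  ∫ ω, ((anchCut M H A ω).toNat : ℝ) ∂(bondPercolation (zdGraph 3) p)

/-- The anchored box of SCALE `m` is `(M,H,A) = (8m, 2m, m)`; `E_p(m) := E_p τ(8m,2m,m)`. [folklore] -/
def expScale (p : unitInterval) (m : ℕ) : ℝ := expCut p (8 * m) (2 * m) m

/-- `MinCut(n,2n)(ω)`: the min-cut budget of the annulus `box n → ∂ⁱⁿ box 2n` inside `box 2n`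
(`minOpenCutIn_le_iff` is verbatim the crux's event). [folklore] -/
abbrev annCut (n : ℕ) (ω : BondConfig (Site 3)) : ℕ∞ :=
  minOpenCutIn (↑(box 3 (2 * n)) : Set (Site 3)) ↑(box 3 n) ↑(innerBoundary (zdGraph 3) (box 3 (2 * n))) ω

/-- `E_p MinCut(n,2n)`. [folklore] -/
def expAnn (p : unitInterval) (n : ℕ) : ℝ :=
  ∫ ω, ((annCut n ω).toNat : ℝ) ∂(bondPercolation (zdGraph 3) p)

/-- The anchored pinhole DENSITY at octave `k`: `u_k = E_{p_c} τ(8·2^k, 2·2^k, 2^k) / 4^k`. [folklore] -/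
def dens (k : ℕ) : ℝ := expScale (criticalProbI 3) (2 ^ k) / ((2 : ℝ) ^ k) ^ 2

/-! ## §1 The three stub statements, name-keyed and def-free (what `DefectDimension_of` takes) -/

namespace Sig

/-- Name-keyed statement of `stub_gluing` (C1). [folklore] -/
def stub_gluing : Prop :=
  ∀ (p : unitInterval) (n : ℕ), 1 ≤ n →
      ∫ ω, ((minOpenCutIn
        {x : Site 3 | 0 ≤ x 0 ∧ x 0 ≤ ((8 * (2 * n) : ℕ) : ℤ) ∧ 0 ≤ x 1 ∧ x 1 ≤ ((8 * (2 * n) : ℕ) : ℤ) ∧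
          0 ≤ x 2 ∧ x 2 ≤ ((2 * (2 * n) : ℕ) : ℤ)}
        {x : Site 3 | x 2 = 0 ∨ ((x 0 = 0 ∨ x 0 = ((8 * (2 * n) : ℕ) : ℤ) ∨ x 1 = 0 ∨ x 1 = ((8 * (2 * n) : ℕ) : ℤ)) ∧
          x 2 < ((2 * n : ℕ) : ℤ))}
        {x : Site 3 | x 2 = ((2 * (2 * n) : ℕ) : ℤ) ∨ ((x 0 = 0 ∨ x 0 = ((8 * (2 * n) : ℕ) : ℤ) ∨ x 1 = 0 ∨ x 1 = ((8 * (2 * n) : ℕ) : ℤ)) ∧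
          ((2 * n : ℕ) : ℤ) ≤ x 2)} ω).toNat : ℝ)
        ∂(bondPercolation (zdGraph 3) p) ≤
      4 * ∫ ω, ((minOpenCutIn
        {x : Site 3 | 0 ≤ x 0 ∧ x 0 ≤ ((8 * n : ℕ) : ℤ) ∧ 0 ≤ x 1 ∧ x 1 ≤ ((8 * n : ℕ) : ℤ) ∧
          0 ≤ x 2 ∧ x 2 ≤ ((2 * n : ℕ) : ℤ)}
        {x : Site 3 | x 2 = 0 ∨ ((x 0 = 0 ∨ x 0 = ((8 * n : ℕ) : ℤ) ∨ x 1 = 0 ∨ x 1 = ((8 * n : ℕ) : ℤ)) ∧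
          x 2 < ((n : ℕ) : ℤ))}
        {x : Site 3 | x 2 = ((2 * n : ℕ) : ℤ) ∨ ((x 0 = 0 ∨ x 0 = ((8 * n : ℕ) : ℤ) ∨ x 1 = 0 ∨ x 1 = ((8 * n : ℕ) : ℤ)) ∧
          ((n : ℕ) : ℤ) ≤ x 2)} ω).toNat : ℝ)
        ∂(bondPercolation (zdGraph 3) p)

/-- Name-keyed statement of `stub_routing` (C2). [folklore] -/
def stub_routing : Prop :=
  ∀ (p : unitInterval) (m n : ℕ), 1 ≤ m → 4 * m ≤ n → n < 8 * m →
      ∫ ω, ((minOpenCutIn (↑(box 3 (2 * n)) : Set (Site 3)) ↑(box 3 n)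
        ↑(innerBoundary (zdGraph 3) (box 3 (2 * n))) ω).toNat : ℝ)
        ∂(bondPercolation (zdGraph 3) p) ≤
      96 * ∫ ω, ((minOpenCutIn
        {x : Site 3 | 0 ≤ x 0 ∧ x 0 ≤ ((8 * m : ℕ) : ℤ) ∧ 0 ≤ x 1 ∧ x 1 ≤ ((8 * m : ℕ) : ℤ) ∧
          0 ≤ x 2 ∧ x 2 ≤ ((2 * m : ℕ) : ℤ)}
        {x : Site 3 | x 2 = 0 ∨ ((x 0 = 0 ∨ x 0 = ((8 * m : ℕ) : ℤ) ∨ x 1 = 0 ∨ x 1 = ((8 * m : ℕ) : ℤ)) ∧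
          x 2 < ((m : ℕ) : ℤ))}
        {x : Site 3 | x 2 = ((2 * m : ℕ) : ℤ) ∨ ((x 0 = 0 ∨ x 0 = ((8 * m : ℕ) : ℤ) ∨ x 1 = 0 ∨ x 1 = ((8 * m : ℕ) : ℤ)) ∧
          ((m : ℕ) : ℤ) ≤ x 2)} ω).toNat : ℝ)
        ∂(bondPercolation (zdGraph 3) p)

/-- Name-keyed statement of `stub_contraction` (C3′, the open core). [folklore] -/
def stub_contraction : Prop :=
  ∃ q δ : ℝ, 0 < q ∧ q < 1 ∧ 0 < δ ∧ ∀ᶠ K : ℕ in Filter.atTop,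
      δ * (K : ℝ) ≤ (Set.ncard {k : ℕ | k < K ∧
        ∫ ω, ((minOpenCutIn
          {x : Site 3 | 0 ≤ x 0 ∧ x 0 ≤ ((8 * 2 ^ (k + 1) : ℕ) : ℤ) ∧ 0 ≤ x 1 ∧ x 1 ≤ ((8 * 2 ^ (k + 1) : ℕ) : ℤ) ∧
            0 ≤ x 2 ∧ x 2 ≤ ((2 * 2 ^ (k + 1) : ℕ) : ℤ)}
          {x : Site 3 | x 2 = 0 ∨ ((x 0 = 0 ∨ x 0 = ((8 * 2 ^ (k + 1) : ℕ) : ℤ) ∨ x 1 = 0 ∨ x 1 = ((8 * 2 ^ (k + 1) : ℕ) : ℤ)) ∧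
            x 2 < ((2 ^ (k + 1) : ℕ) : ℤ))}
          {x : Site 3 | x 2 = ((2 * 2 ^ (k + 1) : ℕ) : ℤ) ∨ ((x 0 = 0 ∨ x 0 = ((8 * 2 ^ (k + 1) : ℕ) : ℤ) ∨ x 1 = 0 ∨ x 1 = ((8 * 2 ^ (k + 1) : ℕ) : ℤ)) ∧
            ((2 ^ (k + 1) : ℕ) : ℤ) ≤ x 2)} ω).toNat : ℝ)
          ∂(bondPercolation (zdGraph 3) (criticalProbI 3)) ≤
        4 * (1 - q) * ∫ ω, ((minOpenCutIn
          {x : Site 3 | 0 ≤ x 0 ∧ x 0 ≤ ((8 * 2 ^ k : ℕ) : ℤ) ∧ 0 ≤ x 1 ∧ x 1 ≤ ((8 * 2 ^ k : ℕ) : ℤ) ∧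
            0 ≤ x 2 ∧ x 2 ≤ ((2 * 2 ^ k : ℕ) : ℤ)}
          {x : Site 3 | x 2 = 0 ∨ ((x 0 = 0 ∨ x 0 = ((8 * 2 ^ k : ℕ) : ℤ) ∨ x 1 = 0 ∨ x 1 = ((8 * 2 ^ k : ℕ) : ℤ)) ∧
            x 2 < ((2 ^ k : ℕ) : ℤ))}
          {x : Site 3 | x 2 = ((2 * 2 ^ k : ℕ) : ℤ) ∨ ((x 0 = 0 ∨ x 0 = ((8 * 2 ^ k : ℕ) : ℤ) ∨ x 1 = 0 ∨ x 1 = ((8 * 2 ^ k : ℕ) : ℤ)) ∧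
            ((2 ^ k : ℕ) : ℤ) ≤ x 2)} ω).toNat : ℝ)
          ∂(bondPercolation (zdGraph 3) (criticalProbI 3))} : ℝ)

end Sig

/-! ## §2 Registered stubs (the only `sorry`s of the file; statements spelled out def-free) -/

/-- **stub_gluing (C1 — exact dyadic sub-multiplicativity of the anchored cut; provable now, M).**
For every `p` and `n ≥ 1`: `E_p τ(16n,4n,2n) ≤ 4·E_p τ(8n,2n,n)` (scale `2n` versus scale `n`).
Proof route (paper proofs: FindingsIdeator1 §3 with the precise selection of §5.0, re-derived by
all three triagers): for LATTICE `ω` (a.s., `ProbabilityTheory.setBernoulli_ae_subset`), (G2) every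
anchored cutset of the middle sub-slab `M = [0,16n]²×[n,3n]` anchored at `2n` is an anchored cutset
of `Q = [0,16n]²×[0,4n]` anchored at `2n` (for a source→sink walk of `Q` take `T` = first visit of
`sinks(M) = {x₂ = 3n} ∪ (Lat ∩ {2n ≤ x₂ ≤ 3n})` and `S` = last visit before `T` of
`sources(M) = {x₂ = n} ∪ (Lat ∩ {n ≤ x₂ < 2n})`; unit steps in `x₂` keep the segment inside `M`;
one-edge segments and `n = 1` included), so `τ_Q ≤ τ_M` (`minOpenCutIn` anti-monotone under
enlarging the cutset family); (G1, Kesten) the union of anchored cutsets of the four tiles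
`[8ni,8n(i+1)]×[8nj,8n(j+1)]×[n,3n]` (each anchored at `2n`, seams `x₀ = 8n`, `x₁ = 8n` shared) is an
anchored cutset of `M` — the segment between the last LOW* and the first HIGH* visit avoids the
seam planes, hence lives in ONE tile and joins that tile's sources to its sinks — so
`τ_M ≤ Σ_{4 tiles} τ_tile` (`minOpenCutIn_le_card`, `Finset.card_biUnion_le`); each `τ_tile` is
`τ(8n,2n,n)` composed with a lattice translation (`BondPercolationSymmetry`:
`bondPercolation_real_preimage_shift`), and all cuts are bounded by the number of pairs in the box
(integrable) and have measurable sub-level sets (`measurableSet_setOf_minOpenCutIn_le`).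
≈ 400–600 lines. [cite: Kesten1987, §2 (lateral subadditivity of the anchored cut)] -/
theorem stub_gluing :
    ∀ (p : unitInterval) (n : ℕ), 1 ≤ n →
      ∫ ω, ((minOpenCutIn
        {x : Site 3 | 0 ≤ x 0 ∧ x 0 ≤ ((8 * (2 * n) : ℕ) : ℤ) ∧ 0 ≤ x 1 ∧ x 1 ≤ ((8 * (2 * n) : ℕ) : ℤ) ∧
          0 ≤ x 2 ∧ x 2 ≤ ((2 * (2 * n) : ℕ) : ℤ)}
        {x : Site 3 | x 2 = 0 ∨ ((x 0 = 0 ∨ x 0 = ((8 * (2 * n) : ℕ) : ℤ) ∨ x 1 = 0 ∨ x 1 = ((8 * (2 * n) : ℕ) : ℤ)) ∧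
          x 2 < ((2 * n : ℕ) : ℤ))}
        {x : Site 3 | x 2 = ((2 * (2 * n) : ℕ) : ℤ) ∨ ((x 0 = 0 ∨ x 0 = ((8 * (2 * n) : ℕ) : ℤ) ∨ x 1 = 0 ∨ x 1 = ((8 * (2 * n) : ℕ) : ℤ)) ∧
          ((2 * n : ℕ) : ℤ) ≤ x 2)} ω).toNat : ℝ)
        ∂(bondPercolation (zdGraph 3) p) ≤
      4 * ∫ ω, ((minOpenCutIn
        {x : Site 3 | 0 ≤ x 0 ∧ x 0 ≤ ((8 * n : ℕ) : ℤ) ∧ 0 ≤ x 1 ∧ x 1 ≤ ((8 * n : ℕ) : ℤ) ∧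
          0 ≤ x 2 ∧ x 2 ≤ ((2 * n : ℕ) : ℤ)}
        {x : Site 3 | x 2 = 0 ∨ ((x 0 = 0 ∨ x 0 = ((8 * n : ℕ) : ℤ) ∨ x 1 = 0 ∨ x 1 = ((8 * n : ℕ) : ℤ)) ∧
          x 2 < ((n : ℕ) : ℤ))}
        {x : Site 3 | x 2 = ((2 * n : ℕ) : ℤ) ∨ ((x 0 = 0 ∨ x 0 = ((8 * n : ℕ) : ℤ) ∨ x 1 = 0 ∨ x 1 = ((8 * n : ℕ) : ℤ)) ∧
          ((n : ℕ) : ℤ) ≤ x 2)} ω).toNat : ℝ)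
        ∂(bondPercolation (zdGraph 3) p) := by
  sorry

/-- **stub_routing (C2 — the annulus budget is at most 96 anchored face pieces; provable now, M).**
For every `p` and `1 ≤ m`, `4m ≤ n < 8m`: `E_p MinCut(n,2n) ≤ 96 · E_p τ(8m,2m,m)`.
Proof route: (i) last-exit routing — every open crossing of `A(n,2n)` inside `box 2n` (lattice `ω`)
contains an inner-face→outer-face crossing of one of the six face slabs
`Q_i^± = {x ∈ box 2n : n+1 ≤ ±x_i ≤ 2n}`; (ii) inside `Q_i^±` it crosses, bottom to top, the
thinner slab of heights `[n+1, n+1+2m]` (`2m ≤ n-1` from `4m ≤ n`), whose lateral extent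
`[-2n, -2n+32m]² ⊇ [-2n,2n]²` (`32m ≥ 4n+1` from `n < 8m`) is tiled `4 × 4` by translates of
`Q(8m,2m)` anchored at mid-height; by G1 (as in `stub_gluing`) the union of the 16 anchored tile
cutsets is an anchored cutset of the big thin slab, in particular separates its bottom from its
top, and tiles sticking out of `box 2n` only over-count (`IsOpenCutsetIn.anti_set`); (iii)
`minOpenCutIn_le_sum_of_routing` in the variant with `hroute` restricted to lattice
sub-configurations `ω' ⊆ ω ⊆ E(ℤ³)` (triage r1-2 F2: the all-`ω'` hypothesis is false for junk
pairs; 10-line variant), expectation, translation/rotation invariance of `bondPercolation`.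
≈ 300–500 lines. [cite: Zhang2000, proof of Thm 1 (six-slab routing); RossignolTheret2018, Prop 3.9] -/
theorem stub_routing :
    ∀ (p : unitInterval) (m n : ℕ), 1 ≤ m → 4 * m ≤ n → n < 8 * m →
      ∫ ω, ((minOpenCutIn (↑(box 3 (2 * n)) : Set (Site 3)) ↑(box 3 n)
        ↑(innerBoundary (zdGraph 3) (box 3 (2 * n))) ω).toNat : ℝ)
        ∂(bondPercolation (zdGraph 3) p) ≤
      96 * ∫ ω, ((minOpenCutIn
        {x : Site 3 | 0 ≤ x 0 ∧ x 0 ≤ ((8 * m : ℕ) : ℤ) ∧ 0 ≤ x 1 ∧ x 1 ≤ ((8 * m : ℕ) : ℤ) ∧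
          0 ≤ x 2 ∧ x 2 ≤ ((2 * m : ℕ) : ℤ)}
        {x : Site 3 | x 2 = 0 ∨ ((x 0 = 0 ∨ x 0 = ((8 * m : ℕ) : ℤ) ∨ x 1 = 0 ∨ x 1 = ((8 * m : ℕ) : ℤ)) ∧
          x 2 < ((m : ℕ) : ℤ))}
        {x : Site 3 | x 2 = ((2 * m : ℕ) : ℤ) ∨ ((x 0 = 0 ∨ x 0 = ((8 * m : ℕ) : ℤ) ∨ x 1 = 0 ∨ x 1 = ((8 * m : ℕ) : ℤ)) ∧
          ((m : ℕ) : ℤ) ≤ x 2)} ω).toNat : ℝ)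
        ∂(bondPercolation (zdGraph 3) p) := by
  sorry

/-- **stub_contraction (C3′ — releasing the internal pins saves a fixed fraction on a positive
density of octaves; THE OPEN CORE, L–XL).**  There are `q ∈ (0,1)` and `δ > 0` such that for all
large `K`, at least `δK` of the octaves `k < K` satisfy
`E_{p_c} τ(8·2^{k+1}, 2·2^{k+1}, 2^{k+1}) ≤ 4(1-q) · E_{p_c} τ(8·2^k, 2·2^k, 2^k)`, i.e.
`u_{k+1} ≤ (1-q) u_k` for the density `u_k = E_{p_c} τ(8·2^k,2·2^k,2^k)/4^k`: at a contracting octave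
the optimal surface pinned only on the OUTER boundary of `Q(16n,4n)` beats, by the fraction `q`, the
glued competitor, which is additionally pinned at height `2n` along the internal cross of seams
(`stub_gluing` says the glued competitor never loses: `u_{k+1} ≤ u_k`).  This is the
density-of-good-octaves weakening (triage r1-1 (i), r1-3 (ii)) of the card's uniform
`AnchoredContraction`; it is where `p = p_c < 1` is USED (false at `p = 1`:
`τ ≡ (8m+1)²`, `u_{k+1}/u_k → 1`; trivially true below `p_c` by sharpness).  Why plausibly true:
physically `u_k ≍ 2^{-0.975k}` (boundary one-arm density, Deng–Blöte) plus the perimeter-forced part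
`≍ 2^{-k}`, so EVERY large octave contracts with `q ≈ 0.49`; the stub asks only for a positive
density of them and a small `q`.  Failure mode identified by the card: self-averaging of `τ` at
scales where the interior pinhole density plateaus while dominating the forced perimeter part
`p_c·32·2^k` (triage r1-1 (iii)).  Attack routes: (a) shape-sensitivity of the optimal seam
profile — `τ_M ≤ min over seam-anchor profiles a′ of Σ_tiles τ_tile^{(a′)}` (G1 holds for any common
profile), so it suffices that the flat profile is beaten by a fraction with probability bounded
below on the event carrying a fixed share of `E Σ τ_tile`; (b) the dichotomy "either `u_k` already
`≤ C·2^{-k}` (then the octave contracts for free with any `q < 1/2` up to the interior share) or the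
interior dominates and non-concentration of the critical pinned cut makes the seams exploitable"
(variance LOWER bounds à la BKS/Chatterjee/Dembin–Elboim–Peled, never tried at zero surface
tension); (c) numerics first: kit j009173 / j009529 measure `u_k`, the forced part and `q_k` for
`k ≤ 5`. [cite: RossignolTheret2018, Prop 2.1 and Prop 3.9 (ν(p_c) = 0: u_k → 0 without rate)] -/
theorem stub_contraction :
    ∃ q δ : ℝ, 0 < q ∧ q < 1 ∧ 0 < δ ∧ ∀ᶠ K : ℕ in Filter.atTop,
      δ * (K : ℝ) ≤ (Set.ncard {k : ℕ | k < K ∧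
        ∫ ω, ((minOpenCutIn
          {x : Site 3 | 0 ≤ x 0 ∧ x 0 ≤ ((8 * 2 ^ (k + 1) : ℕ) : ℤ) ∧ 0 ≤ x 1 ∧ x 1 ≤ ((8 * 2 ^ (k + 1) : ℕ) : ℤ) ∧
            0 ≤ x 2 ∧ x 2 ≤ ((2 * 2 ^ (k + 1) : ℕ) : ℤ)}
          {x : Site 3 | x 2 = 0 ∨ ((x 0 = 0 ∨ x 0 = ((8 * 2 ^ (k + 1) : ℕ) : ℤ) ∨ x 1 = 0 ∨ x 1 = ((8 * 2 ^ (k + 1) : ℕ) : ℤ)) ∧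
            x 2 < ((2 ^ (k + 1) : ℕ) : ℤ))}
          {x : Site 3 | x 2 = ((2 * 2 ^ (k + 1) : ℕ) : ℤ) ∨ ((x 0 = 0 ∨ x 0 = ((8 * 2 ^ (k + 1) : ℕ) : ℤ) ∨ x 1 = 0 ∨ x 1 = ((8 * 2 ^ (k + 1) : ℕ) : ℤ)) ∧
            ((2 ^ (k + 1) : ℕ) : ℤ) ≤ x 2)} ω).toNat : ℝ)
          ∂(bondPercolation (zdGraph 3) (criticalProbI 3)) ≤
        4 * (1 - q) * ∫ ω, ((minOpenCutIn
          {x : Site 3 | 0 ≤ x 0 ∧ x 0 ≤ ((8 * 2 ^ k : ℕ) : ℤ) ∧ 0 ≤ x 1 ∧ x 1 ≤ ((8 * 2 ^ k : ℕ) : ℤ) ∧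
            0 ≤ x 2 ∧ x 2 ≤ ((2 * 2 ^ k : ℕ) : ℤ)}
          {x : Site 3 | x 2 = 0 ∨ ((x 0 = 0 ∨ x 0 = ((8 * 2 ^ k : ℕ) : ℤ) ∨ x 1 = 0 ∨ x 1 = ((8 * 2 ^ k : ℕ) : ℤ)) ∧
            x 2 < ((2 ^ k : ℕ) : ℤ))}
          {x : Site 3 | x 2 = ((2 * 2 ^ k : ℕ) : ℤ) ∨ ((x 0 = 0 ∨ x 0 = ((8 * 2 ^ k : ℕ) : ℤ) ∨ x 1 = 0 ∨ x 1 = ((8 * 2 ^ k : ℕ) : ℤ)) ∧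
            ((2 ^ k : ℕ) : ℤ) ≤ x 2)} ω).toNat : ℝ)
          ∂(bondPercolation (zdGraph 3) (criticalProbI 3))} : ℝ) := by
  sorry

/-! ### Consistency: each name-keyed statement IS its stub (definitionally) -/

theorem stub_gluing_registered : Sig.stub_gluing := stub_gluing
theorem stub_routing_registered : Sig.stub_routing := stub_routing
theorem stub_contraction_registered : Sig.stub_contraction := stub_contraction

/-! ## §3 Bridges: the def-free texts are the local vocabulary, by `rfl` -/

/-- C1 in the local vocabulary. [folklore] -/
theorem sig_gluing_iff :
    Sig.stub_gluing ↔ ∀ (p : unitInterval) (n : ℕ), 1 ≤ n → expScale p (2 * n) ≤ 4 * expScale p n :=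
  Iff.rfl

/-- C2 in the local vocabulary. [folklore] -/
theorem sig_routing_iff :
    Sig.stub_routing ↔ ∀ (p : unitInterval) (m n : ℕ), 1 ≤ m → 4 * m ≤ n → n < 8 * m →
      expAnn p n ≤ 96 * expScale p m :=
  Iff.rfl

/-- C3′ in the local vocabulary. [folklore] -/
theorem sig_contraction_iff :
    Sig.stub_contraction ↔ ∃ q δ : ℝ, 0 < q ∧ q < 1 ∧ 0 < δ ∧ ∀ᶠ K : ℕ in Filter.atTop,
      δ * (K : ℝ) ≤ (Set.ncard {k : ℕ | k < K ∧
        expScale (criticalProbI 3) (2 ^ (k + 1)) ≤ 4 * (1 - q) * expScale (criticalProbI 3) (2 ^ k)} : ℝ) :=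
  Iff.rfl

/-- Expectations of the (nonnegative) cut functionals are nonnegative. [folklore] -/
theorem expCut_nonneg (p : unitInterval) (M H A : ℕ) : 0 ≤ expCut p M H A := by
  unfold expCut
  exact integral_nonneg fun ω => Nat.cast_nonneg _

theorem expScale_nonneg (p : unitInterval) (m : ℕ) : 0 ≤ expScale p m := expCut_nonneg p _ _ _

theorem dens_nonneg (k : ℕ) : 0 ≤ dens k := div_nonneg (expScale_nonneg _ _) (by positivity)

/-! ## §4 Real analysis: a non-increasing sequence contracting on a set of steps decays -/

/-- The contracting ("good") steps below `K` of a sequence `u` at ratio `r`. [folklore] -/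
def goodSet (u : ℕ → ℝ) (r : ℝ) (K : ℕ) : Set ℕ := {k : ℕ | k < K ∧ u (k + 1) ≤ r * u k}

theorem mem_goodSet {u : ℕ → ℝ} {r : ℝ} {K k : ℕ} :
    k ∈ goodSet u r K ↔ k < K ∧ u (k + 1) ≤ r * u k := Iff.rfl

theorem goodSet_finite (u : ℕ → ℝ) (r : ℝ) (K : ℕ) : (goodSet u r K).Finite :=
  (Set.finite_lt_nat K).subset fun _ hk => hk.1

theorem goodSet_zero (u : ℕ → ℝ) (r : ℝ) : goodSet u r 0 = ∅ := by
  ext k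
  simp [mem_goodSet]

theorem goodSet_succ_subset_insert (u : ℕ → ℝ) (r : ℝ) (K : ℕ) :
    goodSet u r (K + 1) ⊆ insert K (goodSet u r K) := by
  intro k hk
  rcases (Nat.lt_succ_iff.1 hk.1).lt_or_eq with h | h
  · exact Set.mem_insert_of_mem _ ⟨h, hk.2⟩
  · rw [h]
    exact Set.mem_insert _ _

theorem goodSet_succ_subset_of_not {u : ℕ → ℝ} {r : ℝ} {K : ℕ} (hK : ¬ u (K + 1) ≤ r * u K) :
    goodSet u r (K + 1) ⊆ goodSet u r K := by
  intro k hk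
  rcases (Nat.lt_succ_iff.1 hk.1).lt_or_eq with h | h
  · exact ⟨h, hk.2⟩
  · exact absurd (h ▸ hk.2) hK

/-- **Decay from good octaves.** A nonnegative-started, non-increasing sequence that contracts by
the factor `r ∈ [0,1]` on the steps of `goodSet u r K` satisfies `u K ≤ u 0 · r^{#goodSet}`.
[folklore] -/
theorem decay_of_good_octaves {u : ℕ → ℝ} {r : ℝ} (hr0 : 0 ≤ r) (hr1 : r ≤ 1) (hu : 0 ≤ u 0)
    (hmono : ∀ k, u (k + 1) ≤ u k) :
    ∀ K : ℕ, u K ≤ u 0 * r ^ (goodSet u r K).ncard := by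
  intro K
  induction K with
  | zero => simp [goodSet_zero]
  | succ K ih =>
    by_cases hgood : u (K + 1) ≤ r * u K
    · have hcard : (goodSet u r (K + 1)).ncard ≤ (goodSet u r K).ncard + 1 :=
        (Set.ncard_le_ncard (goodSet_succ_subset_insert u r K) ((goodSet_finite u r K).insert K)).trans
          (Set.ncard_insert_le _ _)
      calc u (K + 1) ≤ r * u K := hgood
        _ ≤ r * (u 0 * r ^ (goodSet u r K).ncard) := mul_le_mul_of_nonneg_left ih hr0
        _ = u 0 * r ^ ((goodSet u r K).ncard + 1) := by ring
        _ ≤ u 0 * r ^ (goodSet u r (K + 1)).ncard :=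
          mul_le_mul_of_nonneg_left (pow_le_pow_of_le_one hr0 hr1 hcard) hu
    · have hcard : (goodSet u r (K + 1)).ncard ≤ (goodSet u r K).ncard :=
        Set.ncard_le_ncard (goodSet_succ_subset_of_not hgood) (goodSet_finite u r K)
      calc u (K + 1) ≤ u K := hmono K
        _ ≤ u 0 * r ^ (goodSet u r K).ncard := ih
        _ ≤ u 0 * r ^ (goodSet u r (K + 1)).ncard :=
          mul_le_mul_of_nonneg_left (pow_le_pow_of_le_one hr0 hr1 hcard) hu

/-! ## §4b The mean normal form of r4, PROVED: a polynomial mean bound for `MinCut(n,2n)` gives the crux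

(The reduction every engine line of this crux targets — triage r1-1 "sharpen (crux-wide)", r1-3 panel
notes; proved here so that it is not a stub: finiteness of `MinCut(n,2n)` for every configuration,
measurability, integrability, Markov, `minOpenCutIn_le_iff` + `Nat.floor`.) -/

section MeanForm

/-- For `n ≥ 1` the pairs inside `box 2n` form an open cutset of `A(n,2n)` for EVERY configuration
(`box n ∩ ∂ⁱⁿ box 2n = ∅`, and the first edge of a crossing inside `box 2n` is such a pair). [folklore] -/
theorem isOpenCutsetIn_sym2_box {n : ℕ} (hn : 1 ≤ n) (ω : BondConfig (Site 3)) :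
    IsOpenCutsetIn (↑(box 3 (2 * n)) : Set (Site 3)) ↑(box 3 n)
      ↑(innerBoundary (zdGraph 3) (box 3 (2 * n))) ω ↑((box 3 (2 * n)).sym2) := by
  intro x hx y hy hconn
  obtain ⟨hxS, hyS, ⟨w⟩⟩ := hconn
  cases w with
  | nil =>
    exact DCT16.notMem_box_of_mem_innerBoundary_box (by omega : n < 2 * n)
      (Finset.mem_coe.1 hy) (Finset.mem_coe.1 hx)
  | cons hadj _ =>
    have h := SimpleGraph.induce_adj.1 hadj
    rw [openGraph_adj] at h
    exact h.1.2 (Finset.mem_coe.2 (Finset.mk_mem_sym2_iff.2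
      ⟨Finset.mem_coe.1 hxS, Finset.mem_coe.1 (Subtype.prop _)⟩))

/-- Hence `MinCut(n,2n)(ω) ≤ #pairs(box 2n) < ⊤` for every `ω` (`n ≥ 1`). [folklore] -/
theorem annCut_le_card {n : ℕ} (hn : 1 ≤ n) (ω : BondConfig (Site 3)) :
    annCut n ω ≤ (((box 3 (2 * n)).sym2.card : ℕ) : ℕ∞) :=
  minOpenCutIn_le_card (isOpenCutsetIn_sym2_box hn ω)

theorem annCut_ne_top {n : ℕ} (hn : 1 ≤ n) (ω : BondConfig (Site 3)) : annCut n ω ≠ ⊤ :=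
  ne_top_of_le_ne_top (ENat.coe_ne_top _) (annCut_le_card hn ω)

/-- The budget events `{MinCut(n,2n) ≤ k}` are measurable (`box 2n` is finite). [folklore] -/
theorem measurableSet_annCut_le (n k : ℕ) :
    MeasurableSet {ω : BondConfig (Site 3) | annCut n ω ≤ k} :=
  measurableSet_setOf_minOpenCutIn_le (Finset.finite_toSet _) _ _ k

/-- `ω ↦ MinCut(n,2n)(ω)` is measurable (`n ≥ 1`). [folklore] -/
theorem measurable_annCut {n : ℕ} (hn : 1 ≤ n) : Measurable (annCut n) := by
  rw [ENat.measurable_iff]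
  intro k
  have hset : annCut n ⁻¹' {(k : ℕ∞)} =
      {ω | annCut n ω ≤ k} \ ⋃ j ∈ Finset.range k, {ω | annCut n ω ≤ j} := by
    ext ω
    simp only [Set.mem_preimage, Set.mem_singleton_iff, Set.mem_sdiff, Set.mem_setOf_eq,
      Set.mem_iUnion, Finset.mem_range, exists_prop, not_exists, not_and]
    constructor
    · intro h
      refine ⟨h.le, fun j hj hle => ?_⟩
      rw [h] at hle
      exact absurd (ENat.coe_le_coe.1 hle) (not_le.2 hj)
    · rintro ⟨hle, hnot⟩
      obtain ⟨m, hm⟩ := ENat.ne_top_iff_exists.1 (annCut_ne_top hn ω)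
      rw [← hm] at hle hnot ⊢
      have hmk : m ≤ k := ENat.coe_le_coe.1 hle
      rcases hmk.lt_or_eq with hlt | heq
      · exact absurd le_rfl (hnot m hlt)
      · rw [heq]
  rw [hset]
  exact (measurableSet_annCut_le n k).diff
    (Finset.measurableSet_biUnion _ fun j _ => measurableSet_annCut_le n j)

/-- `ω ↦ MinCut(n,2n)(ω).toNat ∈ ℝ` is measurable (`n ≥ 1`). [folklore] -/
theorem measurable_annCut_toNat_real {n : ℕ} (hn : 1 ≤ n) :
    Measurable fun ω : BondConfig (Site 3) => ((annCut n ω).toNat : ℝ) :=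
  (Measurable.of_discrete (f := fun e : ℕ∞ => (e.toNat : ℝ))).comp (measurable_annCut hn)

/-- … and integrable at every `p` (bounded by `#pairs(box 2n)`). [folklore] -/
theorem integrable_annCut_toNat {n : ℕ} (hn : 1 ≤ n) (p : unitInterval) :
    Integrable (fun ω : BondConfig (Site 3) => ((annCut n ω).toNat : ℝ)) (bondPercolation (zdGraph 3) p) := by
  refine (integrable_const ((((box 3 (2 * n)).sym2.card : ℕ) : ℝ))).mono'
    (measurable_annCut_toNat_real hn).aestronglyMeasurable (ae_of_all _ fun ω => ?_)
  rw [Real.norm_eq_abs, abs_of_nonneg (Nat.cast_nonneg _)]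
  exact_mod_cast ENat.toNat_le_of_le_coe (annCut_le_card hn ω)

/-- **Markov for the budget event**: `P_p(E_n(b)) ≥ 1 - E_p MinCut(n,2n) / b` for `n ≥ 1`, `b > 0`,
where `E_n(b)` is the crux's event with budget `b`. [folklore] -/
theorem one_sub_le_real_budgetEvent {n : ℕ} (hn : 1 ≤ n) (p : unitInterval) {b : ℝ} (hb : 0 < b) :
    1 - expAnn p n / b ≤ (bondPercolation (zdGraph 3) p).real
      {ω | ∃ S : Finset (Sym2 (Site 3)), (S.card : ℝ) ≤ b ∧
        ¬ ∃ x ∈ box 3 n, ∃ y ∈ innerBoundary (zdGraph 3) (box 3 (2 * n)),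
          (ω \ ↑S) ∈ openConnIn ↑(box 3 (2 * n)) x y} := by
  -- the event is `{MinCut ≤ ⌊b⌋₊}`
  have hev : {ω : BondConfig (Site 3) | ∃ S : Finset (Sym2 (Site 3)), (S.card : ℝ) ≤ b ∧
        ¬ ∃ x ∈ box 3 n, ∃ y ∈ innerBoundary (zdGraph 3) (box 3 (2 * n)),
          (ω \ ↑S) ∈ openConnIn ↑(box 3 (2 * n)) x y} = {ω | annCut n ω ≤ ⌊b⌋₊} := by
    ext ω
    rw [Set.mem_setOf_eq, Set.mem_setOf_eq, minOpenCutIn_le_iff]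
    constructor
    · rintro ⟨S, hS, hcut⟩
      exact ⟨S, (Nat.le_floor_iff hb.le).2 hS, hcut⟩
    · rintro ⟨S, hS, hcut⟩
      exact ⟨S, (Nat.le_floor_iff hb.le).1 hS, hcut⟩
  rw [hev]
  -- its complement lies in `{b ≤ MinCut.toNat}`
  have hcompl : {ω : BondConfig (Site 3) | annCut n ω ≤ ⌊b⌋₊}ᶜ ⊆
      {ω | b ≤ ((annCut n ω).toNat : ℝ)} := by
    intro ω hω
    rw [Set.mem_compl_iff, Set.mem_setOf_eq, not_le] at hω
    rw [Set.mem_setOf_eq]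
    obtain ⟨m, hm⟩ := ENat.ne_top_iff_exists.1 (annCut_ne_top hn ω)
    rw [← hm] at hω ⊢
    rw [ENat.toNat_coe]
    have h1 : ⌊b⌋₊ < m := ENat.coe_lt_coe.1 hω
    have h2 := Nat.lt_floor_add_one b
    have h3 : (⌊b⌋₊ : ℝ) + 1 ≤ m := by exact_mod_cast h1
    linarith
  -- Markov
  have hmarkov := mul_meas_ge_le_integral_of_nonneg (μ := bondPercolation (zdGraph 3) p)
    (ae_of_all _ fun ω => (Nat.cast_nonneg _ : (0 : ℝ) ≤ ((annCut n ω).toNat : ℝ)))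
    (integrable_annCut_toNat hn p) b
  have h1 : (bondPercolation (zdGraph 3) p).real {ω : BondConfig (Site 3) | annCut n ω ≤ ⌊b⌋₊}ᶜ ≤
      expAnn p n / b := by
    rw [le_div_iff₀ hb, mul_comm]
    exact (mul_le_mul_of_nonneg_left (measureReal_mono hcompl) hb.le).trans hmarkov
  rw [measureReal_compl (measurableSet_annCut_le n _), probReal_univ] at h1
  linarith

/-- **The mean normal form of r4, proved**: if `E_{p_c} MinCut(n,2n) ≤ C·n^{2-c}` eventually for
some `c > 0`, then `DefectDimension` (with saving `c/2`; the conclusion is the crux's text verbatim —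
`DefectDimension` unfolds to it — so that `DefectDimension_of` stays the only theorem of the file
concluding the crux by name). [folklore] -/
theorem defectDimension_of_meanBound
    (h : ∃ c C : ℝ, 0 < c ∧ ∀ᶠ n : ℕ in Filter.atTop, expAnn (criticalProbI 3) n ≤ C * (n : ℝ) ^ (2 - c)) :
    ∃ c : ℝ, 0 < c ∧ Filter.Tendsto (fun n : ℕ => (bondPercolation (zdGraph 3) (criticalProbI 3)).real
        {ω | ∃ S : Finset (Sym2 (Site 3)), (S.card : ℝ) ≤ (n : ℝ) ^ (2 - c) ∧
          ¬ ∃ x ∈ box 3 n, ∃ y ∈ innerBoundary (zdGraph 3) (box 3 (2 * n)),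
            (ω \ ↑S) ∈ openConnIn ↑(box 3 (2 * n)) x y}) Filter.atTop (nhds 1) := by
  obtain ⟨c, C, hc, hev⟩ := h
  refine ⟨c / 2, by linarith, ?_⟩
  have hlow : Tendsto (fun n : ℕ => 1 - C * (n : ℝ) ^ (-(c / 2))) atTop (𝓝 1) := by
    have h1 : Tendsto (fun n : ℕ => (n : ℝ) ^ (-(c / 2))) atTop (𝓝 0) :=
      (tendsto_rpow_neg_atTop (by linarith : 0 < c / 2)).comp tendsto_natCast_atTop_atTop
    have h2 := h1.const_mul C
    rw [mul_zero] at h2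
    simpa using (tendsto_const_nhds (x := (1 : ℝ))).sub h2
  refine tendsto_of_tendsto_of_tendsto_of_le_of_le' hlow tendsto_const_nhds ?_
    (Eventually.of_forall fun n => measureReal_le_one)
  filter_upwards [hev, eventually_ge_atTop 1] with n hn hn1
  have hnpos : (0 : ℝ) < n := by exact_mod_cast hn1
  have hb : (0 : ℝ) < (n : ℝ) ^ (2 - c / 2) := Real.rpow_pos_of_pos hnpos _
  have key := one_sub_le_real_budgetEvent hn1 (criticalProbI 3) hb
  have hratio : expAnn (criticalProbI 3) n / (n : ℝ) ^ (2 - c / 2) ≤ C * (n : ℝ) ^ (-(c / 2)) := by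
    rw [div_le_iff₀ hb]
    calc expAnn (criticalProbI 3) n ≤ C * (n : ℝ) ^ (2 - c) := hn
      _ = C * ((n : ℝ) ^ (-(c / 2)) * (n : ℝ) ^ (2 - c / 2)) := by
        rw [← Real.rpow_add hnpos, show -(c / 2) + (2 - c / 2) = 2 - c by ring]
      _ = C * (n : ℝ) ^ (-(c / 2)) * (n : ℝ) ^ (2 - c / 2) := by ring
  linarith

end MeanForm

/-! ## §5 Composition (kernel-checked, no `sorry`): the three stubs give the crux BY NAME -/

/-- **`DefectDimension_of`**: C1 + C3′ ⇒ geometric decay of the anchored density along the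
octaves; C2 ⇒ a polynomial mean bound for `MinCut(n,2n)`; the (proved) mean normal form ⇒ the
crux. [folklore] -/
theorem DefectDimension_of (h_gluing : Sig.stub_gluing) (h_routing : Sig.stub_routing)
    (h_contraction : Sig.stub_contraction) :
    Summit.CriticalPhenomena.PercolationContinuityZ3.Theses.PercBudgetLadder.DefectDimension := by
  -- the name-keyed statements, read in the local vocabulary (definitional unfolding)
  have H1 : ∀ (p : unitInterval) (n : ℕ), 1 ≤ n → expScale p (2 * n) ≤ 4 * expScale p n :=
    sig_gluing_iff.1 h_gluing
  have H2 : ∀ (p : unitInterval) (m n : ℕ), 1 ≤ m → 4 * m ≤ n → n < 8 * m →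
      expAnn p n ≤ 96 * expScale p m := sig_routing_iff.1 h_routing
  have H3 := sig_contraction_iff.1 h_contraction
  -- Step 1 (C1): the density is non-increasing along the octaves
  have hmono : ∀ k : ℕ, dens (k + 1) ≤ dens k := by
    intro k
    have hk : expScale (criticalProbI 3) (2 * 2 ^ k) ≤ 4 * expScale (criticalProbI 3) (2 ^ k) :=
      H1 (criticalProbI 3) (2 ^ k) Nat.one_le_two_pow
    have e1 : (2 ^ (k + 1) : ℕ) = 2 * 2 ^ k := pow_succ' 2 k
    have e2 : ((2 : ℝ) ^ (k + 1)) ^ 2 = 4 * ((2 : ℝ) ^ k) ^ 2 := by ring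
    show expScale (criticalProbI 3) (2 ^ (k + 1)) / ((2 : ℝ) ^ (k + 1)) ^ 2 ≤
      expScale (criticalProbI 3) (2 ^ k) / ((2 : ℝ) ^ k) ^ 2
    rw [e1, e2, div_le_iff₀ (by positivity)]
    have e3 : expScale (criticalProbI 3) (2 ^ k) / ((2 : ℝ) ^ k) ^ 2 * (4 * ((2 : ℝ) ^ k) ^ 2) =
        4 * expScale (criticalProbI 3) (2 ^ k) := by
      have : ((2 : ℝ) ^ k) ^ 2 ≠ 0 := by positivity
      field_simp
    rw [e3]
    exact hk
  -- Step 2 (C3′): contraction on a positive density of octaves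
  obtain ⟨q, δ, hq0, hq1, hδ, hev⟩ := H3
  obtain ⟨K₀, hK₀⟩ := Filter.eventually_atTop.1 hev
  have hr0 : (0 : ℝ) < 1 - q := by linarith
  have hr1 : (1 : ℝ) - q < 1 := by linarith
  have hdens0 : 0 ≤ dens 0 := dens_nonneg 0
  -- the contracting octaves of C3′ are the good steps of `dens` at ratio `1 - q`
  have hiff : ∀ k : ℕ, (dens (k + 1) ≤ (1 - q) * dens k ↔
      expScale (criticalProbI 3) (2 ^ (k + 1)) ≤ 4 * (1 - q) * expScale (criticalProbI 3) (2 ^ k)) := by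
    intro k
    have hD1 : (0 : ℝ) < ((2 : ℝ) ^ (k + 1)) ^ 2 := by positivity
    have hD0 : ((2 : ℝ) ^ k) ^ 2 ≠ 0 := by positivity
    show (expScale (criticalProbI 3) (2 ^ (k + 1)) / ((2 : ℝ) ^ (k + 1)) ^ 2 ≤
        (1 - q) * (expScale (criticalProbI 3) (2 ^ k) / ((2 : ℝ) ^ k) ^ 2) ↔ _)
    rw [div_le_iff₀ hD1]
    have e : (1 - q) * (expScale (criticalProbI 3) (2 ^ k) / ((2 : ℝ) ^ k) ^ 2) * ((2 : ℝ) ^ (k + 1)) ^ 2 =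
        4 * (1 - q) * expScale (criticalProbI 3) (2 ^ k) := by
      field_simp
      ring
    rw [e]
  have hset : ∀ K : ℕ, goodSet dens (1 - q) K = {k : ℕ | k < K ∧
      expScale (criticalProbI 3) (2 ^ (k + 1)) ≤ 4 * (1 - q) * expScale (criticalProbI 3) (2 ^ k)} := by
    intro K
    ext k
    rw [mem_goodSet, Set.mem_setOf_eq, hiff k]
  have hind := decay_of_good_octaves hr0.le hr1.le hdens0 hmono
  -- geometric decay: `dens K ≤ dens 0 · ((1-q)^δ)^K` for `K ≥ K₀`
  have hρ0 : (0 : ℝ) < (1 - q) ^ δ := Real.rpow_pos_of_pos hr0 δ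
  have hρ1 : (1 - q) ^ δ < (1 : ℝ) := Real.rpow_lt_one hr0.le hr1 hδ
  have hdecay : ∀ K : ℕ, K₀ ≤ K → dens K ≤ dens 0 * ((1 - q) ^ δ) ^ K := by
    intro K hK
    have h2 : δ * (K : ℝ) ≤ ((goodSet dens (1 - q) K).ncard : ℝ) := by
      rw [hset K]
      exact hK₀ K hK
    have h3 : (1 - q) ^ (goodSet dens (1 - q) K).ncard ≤ ((1 - q) ^ δ) ^ K := by
      rw [← Real.rpow_natCast (1 - q) (goodSet dens (1 - q) K).ncard,
        ← Real.rpow_natCast ((1 - q) ^ δ) K, ← Real.rpow_mul hr0.le]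
      exact Real.rpow_le_rpow_of_exponent_ge hr0 hr1.le h2
    exact (hind K).trans (mul_le_mul_of_nonneg_left h3 hdens0)
  -- the exponent: `(1-q)^δ = 2^{-κ}` with `κ > 0`
  obtain ⟨κ, hκ⟩ : ∃ κ : ℝ, κ = -Real.logb 2 ((1 - q) ^ δ) := ⟨_, rfl⟩
  have hκ0 : 0 < κ := by
    rw [hκ]
    exact neg_pos.2 (Real.logb_neg one_lt_two hρ0 hρ1)
  have h2κ : (2 : ℝ) ^ (-κ) = (1 - q) ^ δ := by
    rw [hκ, neg_neg]
    exact Real.rpow_logb two_pos (by norm_num) hρ0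
  have hρpow : ∀ j : ℕ, ((1 - q) ^ δ) ^ j = ((2 : ℝ) ^ j) ^ (-κ) := by
    intro j
    rw [← h2κ]
    exact Real.rpow_pow_comm (by norm_num) (-κ) j
  -- Step 3 (C2 + mean form): `E MinCut(n,2n) ≤ 6·u₀·8^κ · n^{2-κ}` for `n ≥ 2^{K₀+2}`
  refine defectDimension_of_meanBound ⟨κ, 6 * dens 0 * (8 : ℝ) ^ κ, hκ0, ?_⟩
  rw [Filter.eventually_atTop]
  refine ⟨2 ^ (K₀ + 2), fun n hn => ?_⟩
  have hn0 : n ≠ 0 := by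
    have : 1 ≤ 2 ^ (K₀ + 2) := Nat.one_le_two_pow
    omega
  have hL : K₀ + 2 ≤ Nat.log 2 n := Nat.le_log_of_pow_le one_lt_two hn
  have hpow_le : 2 ^ Nat.log 2 n ≤ n := Nat.pow_log_le_self 2 hn0
  have hlt_pow : n < 2 ^ (Nat.log 2 n).succ := Nat.lt_pow_succ_log_self one_lt_two n
  obtain ⟨j, hj⟩ : ∃ j : ℕ, Nat.log 2 n = j + 2 := ⟨Nat.log 2 n - 2, by omega⟩
  have hjK : K₀ ≤ j := by omega
  rw [hj] at hpow_le hlt_pow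
  have h4le : 4 * 2 ^ j ≤ n :=
    calc 4 * 2 ^ j = 2 ^ (j + 2) := by ring
      _ ≤ n := hpow_le
  have h8lt : n < 8 * 2 ^ j :=
    calc n < 2 ^ (j + 2).succ := hlt_pow
      _ = 8 * 2 ^ j := by rw [Nat.succ_eq_add_one]; ring
  have hnpos : (0 : ℝ) < n := by exact_mod_cast Nat.pos_of_ne_zero hn0
  have hreal4 : (4 : ℝ) * 2 ^ j ≤ n := by exact_mod_cast h4le
  have hreal8 : (n : ℝ) < 8 * 2 ^ j := by exact_mod_cast h8lt
  -- routing at scale `m = 2^j`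
  have hR : expAnn (criticalProbI 3) n ≤ 96 * expScale (criticalProbI 3) (2 ^ j) :=
    H2 (criticalProbI 3) (2 ^ j) n Nat.one_le_two_pow h4le h8lt
  have hE : expScale (criticalProbI 3) (2 ^ j) = ((2 : ℝ) ^ j) ^ 2 * dens j := by
    have : ((2 : ℝ) ^ j) ^ 2 ≠ 0 := by positivity
    unfold dens
    field_simp
  have hD : dens j ≤ dens 0 * ((1 - q) ^ δ) ^ j := hdecay j hjK
  have hsq : ((2 : ℝ) ^ j) ^ 2 ≤ (n : ℝ) ^ 2 / 16 := by
    nlinarith [mul_nonneg (sub_nonneg.2 hreal4) (by positivity : (0 : ℝ) ≤ (n : ℝ) + 4 * 2 ^ j)]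
  have hρj : ((1 - q) ^ δ) ^ j ≤ (8 : ℝ) ^ κ * (n : ℝ) ^ (-κ) := by
    rw [hρpow j]
    have hle : (n : ℝ) / 8 ≤ (2 : ℝ) ^ j := by
      rw [div_le_iff₀ (by norm_num : (0 : ℝ) < 8)]
      linarith
    have h1 : ((2 : ℝ) ^ j) ^ (-κ) ≤ ((n : ℝ) / 8) ^ (-κ) :=
      Real.rpow_le_rpow_of_nonpos (by positivity) hle (by linarith)
    have h2 : ((n : ℝ) / 8) ^ (-κ) = (8 : ℝ) ^ κ * (n : ℝ) ^ (-κ) := by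
      rw [Real.div_rpow hnpos.le (by norm_num : (0 : ℝ) ≤ 8), Real.rpow_neg (by norm_num : (0 : ℝ) ≤ 8),
        div_inv_eq_mul, mul_comm]
    exact h1.trans_eq h2
  have hmain : expAnn (criticalProbI 3) n ≤ 6 * dens 0 * (8 : ℝ) ^ κ * ((n : ℝ) ^ 2 * (n : ℝ) ^ (-κ)) :=
    calc expAnn (criticalProbI 3) n ≤ 96 * expScale (criticalProbI 3) (2 ^ j) := hR
      _ = 96 * (((2 : ℝ) ^ j) ^ 2 * dens j) := by rw [hE]
      _ ≤ 96 * ((n : ℝ) ^ 2 / 16 * (dens 0 * ((1 - q) ^ δ) ^ j)) :=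
        mul_le_mul_of_nonneg_left (mul_le_mul hsq hD (dens_nonneg j) (by positivity)) (by norm_num)
      _ ≤ 96 * ((n : ℝ) ^ 2 / 16 * (dens 0 * ((8 : ℝ) ^ κ * (n : ℝ) ^ (-κ)))) :=
        mul_le_mul_of_nonneg_left
          (mul_le_mul_of_nonneg_left (mul_le_mul_of_nonneg_left hρj hdens0) (by positivity)) (by norm_num)
      _ = 6 * dens 0 * (8 : ℝ) ^ κ * ((n : ℝ) ^ 2 * (n : ℝ) ^ (-κ)) := by ring
  have hsplit : (n : ℝ) ^ (2 - κ) = (n : ℝ) ^ 2 * (n : ℝ) ^ (-κ) := by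
    rw [sub_eq_add_neg, Real.rpow_add hnpos, Real.rpow_two]
  rw [hsplit]
  exact hmain

/-- Wiring check: the three registered stubs, as stated, feed `DefectDimension_of` (an `example`, so
that exactly one theorem of the file concludes the crux). -/
example : Summit.CriticalPhenomena.PercolationContinuityZ3.Theses.PercBudgetLadder.DefectDimension :=
  DefectDimension_of stub_gluing stub_routing stub_contraction

/-! ## §6 Landed negative lemmas this stub set is checked against (see the module docstring) -/

/-- `p = 1`: the crux's statement is false (all-open cutsets are areal) — consistent: at `p = 1`
no octave contracts, and `stub_contraction` is stated at `p_c` only. -/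
example := @Summit.CriticalPhenomena.PercolationContinuityZ3.Theorems.DefectDimension.Negative.defectDimension_false_at_one

/- `p < p_c` (`Theorems/DefectDimension/Negative/Subcritical.lean`, `defectDimension_shape_below_critical`,
proposal p73947 — not imported here until it is built on the farm): below `p_c` the crux's conclusion
holds with every saving — consistent (every octave contracts, by sharpness). -/

end Summit.CriticalPhenomena.PercolationContinuityZ3.Cruxes.DefectDimension.AnchoredDensityContraction

end
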